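import Summits.QuantumFields.YangMills.Theorems.PoincareLipschitzOrbitMinTwistSlack
import HarnessLib

/-!
# Crux `HistoryTailL` (stmt-QuantumFields-19936), K2 face v2 `hRegH` (route crux `PoincareLipschitz.BlockLipschitzL`, stmt-QuantumFields-23533) —
# THE FINAL KNIT `hRegH ⟸ hImprove ∧ [C]`, FILE K-2a «FLAT END-GAME LETTERS»: the CONSTANT twist slack (the minimality-with-slack clause of the displayed
# [C]-socket `hC`), the twisted-vs-flat bond, and the twisted-vs-flat energy

Cell `ym3-torus` (YM ladder rung R3 = continuum SU(2) Yang–Mills on T³ — a RUNG, NOT the Clay problem: not d = 4, not infinite volume, not a mass gap);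
LEAD seat `ym-ust-19936-w1` g9 (bus 2026-08-29T06:49:23Z «K-2 FLAT END-GAME» architecture; RULINGS g9-1 «[C] stays flat with the additive twist slack»,
g9-3∕g9-5 «hImprove v1: exponent 6 + window»).  Helper `--supports stmt-QuantumFields-19936`; THEOREMS ONLY (0 `def`, 0 `sorry`, default heartbeats),
pure real analysis + the flat-shadow letters `u : ℤ^d → V`, `τ μ y : V ≃ₗᵢ V` of ✓`PoincareLipschitzOrbitMinTwistSlack`.  File K-2b composes these with
`hImprove` v1, the displayed [C]-socket `hC` (2e0c4712) and the door ✓p701912 into the flat bond bound; nothing here proves `hImprove`, [C], `hRegH`,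
`BlockLipschitzL`, `HistoryTailL` or a summit statement.

WHAT IS PROVED (ns `…Theorems.PoincareLipschitzKnitFlatEndgame`).
* §1 `energy_le_two_mul_twist` (`E ≤ 2E_τ + 6τ₀²·(d·#Q)` from ✓`energy_le_twist` by `2τ₀√(NE) ≤ E∕2 + 2τ₀²N`), `norm_twist_sub_le` (`‖τb − a‖ ≤ ‖b − a‖ + τ₀`,
  `‖b‖ = 1`), ★ `flat_almostMin_const_slack` — an exact local minimiser of the TWISTED energy on `Q_{R+1}(x)` whose own flat energy is `≤ T` is an
  almost-minimiser of the FLAT energy with the COMPETITOR-INDEPENDENT slack `4τ₀√(N·T) + 2τ₀²N` (✓`flat_almostMin_of_twisted_localMin` + the case split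
  `E(v) ≤ E(u)` ∕ `E(v) > E(u)`): the minimality-with-slack clause of the [C]-socket `hC`.
(The two SOURCE ROWS of the door for `T r = ε₁r∕(1+log r)⁶` are ★w2 g12's ✓`PoincareLipschitzKnitDoorRows.doorRows_log6`; the ladder and box
one-liners are px8 g5's ✓`PoincareLipschitzKnitLadderLetters`; K-2b composes.)
HONEST SCOPE.  Letters; nothing of the regularity is here.  YM₃ on T³ is rung R3, not Clay; YM gap NOT proved.

References: R. Schoen, K. Uhlenbeck, J. Diff. Geom. 17 (1982) 307–335 [SchoenUhlenbeck1982] (§2: minimality under compactly supported variations);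
M. Giaquinta, Annals of Math. Studies 105 (1983) [Giaquinta1984] (Ch. III §1 p.64).
-/

set_option autoImplicit false

noncomputable section

open scoped BigOperators InnerProductSpace
open Finset

namespace Summit.QuantumFields.YangMills.Theorems.PoincareLipschitzKnitFlatEndgame

open Literature.MathematicalPhysics.QuantumFieldTheory.Balaban1983to89
open B4Eq19LatticeOperators (Zd box unitVec mem_box box_mono box_subset_box self_mem_box add_unitVec_mem_box sub_unitVec_mem_box card_box)
open Summit.QuantumFields.YangMills.Theorems.PoincareLipschitzOrbitMinTwistSlack (flat_almostMin_of_twisted_localMin energy_le_twist)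

variable {d : ℕ} {V : Type*} [NormedAddCommGroup V] [InnerProductSpace ℝ V]

/-! ## §1 Letters -/

/-- **FLAT ≤ 2·TWISTED + 6τ₀²N** on a box `Q` (`N = d·#Q`): from ✓`energy_le_twist` and `2τ₀√(N·E) ≤ E∕2 + 2τ₀²N`. [folklore] -/
theorem energy_le_two_mul_twist (τ : Fin d → Zd d → (V ≃ₗᵢ[ℝ] V)) {τ₀ : ℝ} (hτ0 : 0 ≤ τ₀) (Q : Finset (Zd d))
    (hτ : ∀ y ∈ Q, ∀ (μ : Fin d) (w : V), ‖τ μ y w - w‖ ≤ τ₀ * ‖w‖) (f : Zd d → V) (hf : ∀ y ∈ Q, ∀ μ : Fin d, ‖f (y + unitVec μ)‖ = 1) :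
    ∑ y ∈ Q, ∑ μ, ‖f (y + unitVec μ) - f y‖ ^ 2 ≤
      2 * (∑ y ∈ Q, ∑ μ, ‖τ μ y (f (y + unitVec μ)) - f y‖ ^ 2) + 6 * (τ₀ ^ 2 * (d * Q.card : ℝ)) := by
  have h := energy_le_twist τ hτ0 Q hτ f hf
  set E := ∑ y ∈ Q, ∑ μ, ‖f (y + unitVec μ) - f y‖ ^ 2 with hE
  set N : ℝ := (d * Q.card : ℝ) with hN
  have hE0 : 0 ≤ E := Finset.sum_nonneg fun _ _ => Finset.sum_nonneg fun _ _ => sq_nonneg _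
  have hN0 : 0 ≤ N := by rw [hN]; positivity
  have hsN : Real.sqrt N ^ 2 = N := Real.sq_sqrt hN0
  have hsE : Real.sqrt E ^ 2 = E := Real.sq_sqrt hE0
  have hmul : Real.sqrt (N * E) = Real.sqrt N * Real.sqrt E := Real.sqrt_mul hN0 E
  have hamgm : 2 * τ₀ * Real.sqrt (N * E) ≤ E / 2 + 2 * (τ₀ ^ 2 * N) := by
    rw [hmul]
    nlinarith [sq_nonneg (Real.sqrt E - 2 * τ₀ * Real.sqrt N), Real.sqrt_nonneg N, Real.sqrt_nonneg E]
  linarith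

/-- **THE TWISTED BOND IS THE FLAT BOND UP TO THE DEFECT**: `‖τ b − a‖ ≤ ‖b − a‖ + τ₀` when `‖b‖ = 1` and `‖τ w − w‖ ≤ τ₀‖w‖`. [folklore] -/
theorem norm_twist_sub_le (T : V ≃ₗᵢ[ℝ] V) {τ₀ : ℝ} (hT : ∀ v, ‖T v - v‖ ≤ τ₀ * ‖v‖) {a b : V} (hb : ‖b‖ = 1) :
    ‖T b - a‖ ≤ ‖b - a‖ + τ₀ := by
  calc ‖T b - a‖ = ‖(b - a) + (T b - b)‖ := by congr 1; abel
    _ ≤ ‖b - a‖ + ‖T b - b‖ := norm_add_le _ _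
    _ ≤ ‖b - a‖ + τ₀ := by have := hT b; rw [hb, mul_one] at this; linarith

/-- **CONSTANT SLACK**: an exact local minimiser of the TWISTED energy on `Q_{R+1}(x)` (competitors unit on `Q_R(x)`, equal to `u` off it) is an
almost-minimiser of the FLAT energy with the COMPETITOR-INDEPENDENT slack `4τ₀√(N·T) + 2τ₀²N` (`N = d·#Q_{R+1}(x)`) as soon as its own flat energy is
`≤ T` (✓`flat_almostMin_of_twisted_localMin` + the case split `E(v) ≤ E(u)` ∕ `E(v) > E(u)`). [cite: SchoenUhlenbeck1982, §2] -/
theorem flat_almostMin_const_slack (τ : Fin d → Zd d → (V ≃ₗᵢ[ℝ] V)) {τ₀ : ℝ} (hτ0 : 0 ≤ τ₀) (x : Zd d) (R : ℤ)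
    (hτ : ∀ y ∈ box x (R + 1), ∀ (μ : Fin d) (w : V), ‖τ μ y w - w‖ ≤ τ₀ * ‖w‖)
    (u : Zd d → V) (hu1 : ∀ y, ‖u y‖ = 1)
    (hmin : ∀ v : Zd d → V, (∀ y, y ∉ box x R → v y = u y) → (∀ y ∈ box x R, ‖v y‖ = 1) →
      ∑ y ∈ box x (R + 1), ∑ μ, ‖τ μ y (u (y + unitVec μ)) - u y‖ ^ 2 ≤ ∑ y ∈ box x (R + 1), ∑ μ, ‖τ μ y (v (y + unitVec μ)) - v y‖ ^ 2)
    {T : ℝ} (hT : ∑ y ∈ box x (R + 1), ∑ μ, ‖u (y + unitVec μ) - u y‖ ^ 2 ≤ T)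
    (w : Zd d → V) (hw1 : ∀ y, ‖w y‖ = 1) (hw : ∀ y, y ∉ box x R → w y = u y) :
    ∑ y ∈ box x (R + 1), ∑ μ, ‖u (y + unitVec μ) - u y‖ ^ 2 ≤
      (∑ y ∈ box x (R + 1), ∑ μ, ‖w (y + unitVec μ) - w y‖ ^ 2) +
        (4 * τ₀ * Real.sqrt ((d * (box x (R + 1)).card : ℝ) * T) + 2 * (τ₀ ^ 2 * (d * (box x (R + 1)).card : ℝ))) := by
  set Eu := ∑ y ∈ box x (R + 1), ∑ μ, ‖u (y + unitVec μ) - u y‖ ^ 2 with hEu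
  set Ew := ∑ y ∈ box x (R + 1), ∑ μ, ‖w (y + unitVec μ) - w y‖ ^ 2 with hEw
  set N : ℝ := (d * (box x (R + 1)).card : ℝ) with hN
  have hEu0 : 0 ≤ Eu := Finset.sum_nonneg fun _ _ => Finset.sum_nonneg fun _ _ => sq_nonneg _
  have hEw0 : 0 ≤ Ew := Finset.sum_nonneg fun _ _ => Finset.sum_nonneg fun _ _ => sq_nonneg _
  have hN0 : 0 ≤ N := by rw [hN]; positivity
  have hT0 : 0 ≤ T := hEu0.trans hT
  have hslack0 : 0 ≤ 4 * τ₀ * Real.sqrt (N * T) + 2 * (τ₀ ^ 2 * N) := by positivity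
  rcases le_or_gt Ew Eu with hle | hgt
  · have h := flat_almostMin_of_twisted_localMin τ hτ0 x R hτ u hu1 hmin w hw (fun y _ => hw1 y)
    have h1 : Real.sqrt (N * Eu) ≤ Real.sqrt (N * T) := Real.sqrt_le_sqrt (mul_le_mul_of_nonneg_left hT hN0)
    have h2 : Real.sqrt (N * Ew) ≤ Real.sqrt (N * T) := Real.sqrt_le_sqrt (mul_le_mul_of_nonneg_left (hle.trans hT) hN0)
    have h3 : 2 * τ₀ * (Real.sqrt (N * Eu) + Real.sqrt (N * Ew)) ≤ 4 * τ₀ * Real.sqrt (N * T) := by nlinarith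
    change Eu ≤ Ew + 2 * τ₀ * (Real.sqrt (N * Eu) + Real.sqrt (N * Ew)) + 2 * (τ₀ ^ 2 * N) at h
    linarith
  · linarith

end Summit.QuantumFields.YangMills.Theorems.PoincareLipschitzKnitFlatEndgame

end
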